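/- Copyright: the b2b-balaban cell (near-miss cell 7), T⁴-continuum fan-out; row NE7b ROUND-2 swarm, seat
t4-ne7b-formalise-leaf-03 (gen 4) (road W-RP, row W6 «W-ROAD APEX ∕ HEADLINE» of `t4/b2b-balaban-t4-ne7b-p1/LEAVES-NE7b.md`
v3.50, owner's NEW ROW journal l.16605, CLAIM l.16612; file 1 of 3).  Released under the licence of the surrounding project. -/
import Summits.QuantumFields.BalabanUV.T4Continuum.Support.HistoryChessboardEventsCutoff
import Literature.MathematicalPhysics.QuantumFieldTheory.Balaban1983to89.T4ContinuumYM4Torus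

/-!
# Road W-RP, row W6 file 1: THE W-ROAD ENDs UNDER THE APEX PREFIX — NO PIN IS CONSUMED (thresholds `γ₁ = g₁ = 1`)

Summits-side support leaf of the T⁴-continuum cell (rung (B)+1 on a FINITE torus only; NOT infinite volume, NOT the
mass gap, NOT the Clay statement; NOT a proof of the spine estimate NE7b).  Row NE7b, road **W-RP** (R-OWNER-23-2 ∕
R-OWNER-23-8), row **W6**, file 1 — the mirror of the count road's pinned ENDs (`HistoryRealiseCellsRunPinned` p218146,
`…PinnedT3b` p222798, `…PinnedT3bP` p224056) for road W.  The owner's row definition (journal l.16605) asks: «the W-road END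
restated with the apex quantifier order under the pins it actually consumes (if none of (B)∕BetaPertHyp enters the END —
say so: thresholds `γ₁ = g₁ = 1`, the pins enter only at `continuumYM4Torus_of_targets`)».  THIS FILE SAYS SO, IN THE KERNEL.

WHAT.  The W-road END of record `HistoryChessboardAssembly.hybridNE7_of_chessboard` (W4, p218970, ψ-currency: two
`ChessboardReading`s + dressing) and its per-cutoff form `HistoryChessboardEventsCutoff.hybridNE7_of_cutoffReadings` (W4b′,
p220032: two families of `CutoffReading`s on cutoff-dependent carriers) have NO datum `D : FiniteEpsData F G`, NO renormalised
coupling, NO `(B) = B16.EndStatementBPrinted D.C` and NO `BetaPertHyp D.βfun` among their binders — read off the tree: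
their hypotheses are `Even N`, the readings, summable per-cell rates, (W4 only) the two-sided dressing, NE7c's
`ShellWeightBound`, NE7's `ReindexedBudget`, four summable rates.  Hence, for EVERY datum `D`:
* **`hybridNE7_of_cutoffReadings_fsc`** ∕ **`hybridNE7_of_chessboard_fsc`** — the END holds under the discharged apex prefix
  `T4ContinuumYM4Torus.ForSmallCouplings D` with the data bound INSIDE the prefix (apex quantifier order) and thresholds
  `γ₁ = g₁ = 1` (`ForSmallCouplings.of_forall` BY NAME: the conclusion does not mention the tuned run `g₀`);
* **`hybridNE7_of_cutoffReadings_under`** — the same under the FULL apex prefix `D.UnderHypotheses Hβ` for EVERY β-side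
  hypothesis `Hβ` (in particular `BetaPertHyp D.βfun`): the antecedents `(B)` and `Hβ` are accepted and NOT used
  (`ForSmallCouplings.underHypotheses` BY NAME).
So on road W the two pins enter ONLY where the apex lineage's API is phrased with them: `T4ApexHybrid.HybridNE7Under`
(definitionally `(B) → Hβ → ForSmallCouplings …`, `T4ContinuumYM4Torus.underHypotheses_iff`) and
`T4ContinuumYM4Torus.continuumYM4Torus_of_targets` (files 2–3: `HistoryChessboardApex`, `HistoryChessboardHeadline`).  Where (B)'s
CONTENT does enter road W: as a READING inside the witness — the field `univ_le` ((U1)+(G2): a (0.1)-upper-half-KIND numerator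
against (B)'s global lower bound, in ratio currency) — not as the pin by name; and the coupling window enters nowhere (the
W road's rates are geometric in the forced depth, `HistoryChessboardAssembly.summable_pow_of_survivalRate`, not flow-driven).
[folklore] composition by name; no `def`, no `structure`, no `[cite:]` tag, nothing printed asserted, no `Prop` fact minted (c1),
no constant (c2∕c6), no exit ∕ socket ∕ `HistoryConstants` file touched (c3).

HONEST SCOPE (R-OWNER-23-8 wording for road W-RP): a producer of NE7b's socket for the PRINTED, centred 4-d averaging
prescription modulo the DISPLAYED readings (EXT)∕(LOC)∕(R-sym)∕(RP-ext)∕(U1)+(G2) (the fields of `CutoffReading` ∕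
`ChessboardReading`); nothing of the nine discharged; the count 0∕9 unchanged.  NE7b NOT proved; spine 0∕9.  HONEST
DEPENDENCY (cell): continuum YM on T⁴ ⇐ BetaPertH ∧ nine spine estimates (0/9 proved); BetaPertH ⇐ (D1) ∧ (D4) ∧ CAP+tail;
G-an2-4 gates asym, D1 and NE2/3/4.  This file changes none of it. -/

open Finset MeasureTheory
open Literature.MathematicalPhysics.QuantumFieldTheory.Balaban1983to89
open Literature.MathematicalPhysics.QuantumFieldTheory.Balaban1983to89.T4WeightBudget
open Literature.MathematicalPhysics.QuantumFieldTheory.Balaban1983to89.T4IndicatorShell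
open Literature.MathematicalPhysics.QuantumFieldTheory.Balaban1983to89.T4MatchingAssembly
open Literature.MathematicalPhysics.QuantumFieldTheory.Balaban1983to89.T4MatchingClosure
open Literature.Barriers.CriticalPhenomena.NonGibbs Literature.Probability.LatticeModels
open T4Continuum T4ContinuumYM4Torus
open Summit.QuantumFields.BalabanUV.T4Continuum.HistoryChessboardAssembly
open Summit.QuantumFields.BalabanUV.T4Continuum.HistoryChessboardEventsCutoff

namespace Summit.QuantumFields.BalabanUV.T4Continuum.HistoryChessboardPinned

noncomputable section

universe u u' v v'

variable {F : T4Family} {G : Type*} [GaugeGroup G] [MeasurableSpace G] [HaarData G]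

/-- **THE PER-CUTOFF W-ROAD END UNDER THE APEX PREFIX, FOR EVERY DATUM — NO PIN, NO COUPLING WINDOW.**  For every
`D : FiniteEpsData F G`: under `ForSmallCouplings D` (thresholds `γ₁ = g₁ = 1`), for every tuned run, the statement of
`HistoryChessboardEventsCutoff.hybridNE7_of_cutoffReadings` VERBATIM with its data bound inside the prefix (term index and
pattern types, cutoff-dependent carriers with their measurable structures, block counts, the two families of per-cutoff
event readings, summable per-cell rates, NE7c's `ShellWeightBound`, NE7's `ReindexedBudget`, four summable rates ⇒
`∃ K₁ K₂, K₀ ≤ K₁ ∧ HybridNE7 …` with the weight `e^{2·ob·l₀}·#P·N^d·(r + r′)`).  The tuned run `g₀` is NOT mentioned by the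
conclusion: `ForSmallCouplings.of_forall`.  NE7b NOT proved (the readings are displayed). [folklore] -/
theorem hybridNE7_of_cutoffReadings_fsc (D : FiniteEpsData F G) :
    ForSmallCouplings D fun _ =>
      ∀ {ι : Type u} {Λ : Type u'} [DecidableEq ι] {d N : ℕ} [NeZero N] {P : Finset Λ} {T : ℕ → Finset ι} {K₀ : ℕ}
        {Ω : ℕ → Type v} [∀ K, MeasurableSpace (Ω K)] {A : ℕ → ℝ → ι → ℝ} {Bad : ℕ → Finset ι}
        {μ : ∀ K, Measure (Ω K)} {Z : ℕ → ℝ} {ev : ∀ K, ι → Set (Ω K)} {obs : ∀ K, Ω K → ℝ} {ob : ℝ}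
        {E : ∀ K, Λ → BlockIdx d N → Set (Ω K)} {θ : ∀ K, Fin d → ZMod N → Ω K → Ω K}
        {mP : ∀ K, Fin d → ZMod N → MeasurableSpace (Ω K)} {r : ℕ → ℝ}
        {Ω' : ℕ → Type v'} [∀ K, MeasurableSpace (Ω' K)] {B shA shB Cc Rr CcRec RrRec : ℕ → ℝ → ι → ℝ}
        {μ' : ∀ K, Measure (Ω' K)} {Z' : ℕ → ℝ} {ev' : ∀ K, ι → Set (Ω' K)} {obs' : ∀ K, Ω' K → ℝ}
        {E' : ∀ K, Λ → BlockIdx d N → Set (Ω' K)} {θ' : ∀ K, Fin d → ZMod N → Ω' K → Ω' K}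
        {mP' : ∀ K, Fin d → ZMod N → MeasurableSpace (Ω' K)} {r' ν u s₂ c₀ rr s Wsh : ℕ → ℝ} {l₀ vol : ℝ},
      Even N →
      (∀ K, K₀ ≤ K →
        CutoffReading d N P (T K) (A K) (Bad K) (μ K) (Z K) (ev K) (obs K) ob (E K) (θ K) (mP K) (r K)) →
      (∀ K, K₀ ≤ K →
        CutoffReading d N P (T K) (B K) (Bad K) (μ' K) (Z' K) (ev' K) (obs' K) ob (E' K) (θ' K) (mP' K) (r' K)) →
      Summable r → Summable r' →
      ShellWeightBound l₀ T A B shA shB Wsh →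
      ReindexedBudget l₀ vol T (fun K t τ => A K t τ - shA K t τ) (fun K t τ => B K t τ - shB K t τ)
        (fun K _ => Bad K) Cc Rr CcRec RrRec ν u s₂ c₀ rr s →
      Summable rr → Summable u → Summable s → Summable s₂ →
      ∃ K₁ K₂, K₀ ≤ K₁ ∧ HybridNE7 l₀ vol (fun K => T (K₁ + (K₂ + K))) (fun K => A (K₁ + (K₂ + K)))
        (fun K => B (K₁ + (K₂ + K))) (fun K _ => Bad (K₁ + (K₂ + K)))
        (fun K => Real.exp (2 * (ob * l₀)) * ((#P : ℝ) * (N : ℝ) ^ d * (r (K₁ + (K₂ + K)) + r' (K₁ + (K₂ + K)))))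
        (fun K => shA (K₁ + (K₂ + K))) (fun K => shB (K₁ + (K₂ + K))) (fun K => Wsh (K₁ + (K₂ + K)))
        (fun K => (rr (K₁ + (K₂ + K)) + u (K₁ + (K₂ + K))) + (s (K₁ + (K₂ + K)) + s₂ (K₁ + (K₂ + K)))) :=
  ForSmallCouplings.of_forall fun _ => fun hN HA HB hr hr' hSh hTB hrr hu hs hs₂ =>
    hybridNE7_of_cutoffReadings hN HA HB hr hr' hSh hTB hrr hu hs hs₂

/-- **… AND UNDER THE FULL APEX PREFIX FOR EVERY β-SIDE HYPOTHESIS** `Hβ` (e.g. `BetaPertHyp D.βfun`):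
`D.UnderHypotheses Hβ` of the same statement — its antecedents `(B) = B16.EndStatementBPrinted D.C` and `Hβ` are ACCEPTED
AND NOT USED (`ForSmallCouplings.underHypotheses`).  This is the kernel form of «none of (B)∕BetaPertHyp enters the W-road
END; the pins enter only at `continuumYM4Torus_of_targets`» (owner, l.16605). [folklore] -/
theorem hybridNE7_of_cutoffReadings_under (D : FiniteEpsData F G) (Hβ : Prop) :
    D.UnderHypotheses Hβ fun _ =>
      ∀ {ι : Type u} {Λ : Type u'} [DecidableEq ι] {d N : ℕ} [NeZero N] {P : Finset Λ} {T : ℕ → Finset ι} {K₀ : ℕ}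
        {Ω : ℕ → Type v} [∀ K, MeasurableSpace (Ω K)] {A : ℕ → ℝ → ι → ℝ} {Bad : ℕ → Finset ι}
        {μ : ∀ K, Measure (Ω K)} {Z : ℕ → ℝ} {ev : ∀ K, ι → Set (Ω K)} {obs : ∀ K, Ω K → ℝ} {ob : ℝ}
        {E : ∀ K, Λ → BlockIdx d N → Set (Ω K)} {θ : ∀ K, Fin d → ZMod N → Ω K → Ω K}
        {mP : ∀ K, Fin d → ZMod N → MeasurableSpace (Ω K)} {r : ℕ → ℝ}
        {Ω' : ℕ → Type v'} [∀ K, MeasurableSpace (Ω' K)] {B shA shB Cc Rr CcRec RrRec : ℕ → ℝ → ι → ℝ}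
        {μ' : ∀ K, Measure (Ω' K)} {Z' : ℕ → ℝ} {ev' : ∀ K, ι → Set (Ω' K)} {obs' : ∀ K, Ω' K → ℝ}
        {E' : ∀ K, Λ → BlockIdx d N → Set (Ω' K)} {θ' : ∀ K, Fin d → ZMod N → Ω' K → Ω' K}
        {mP' : ∀ K, Fin d → ZMod N → MeasurableSpace (Ω' K)} {r' ν u s₂ c₀ rr s Wsh : ℕ → ℝ} {l₀ vol : ℝ},
      Even N →
      (∀ K, K₀ ≤ K →
        CutoffReading d N P (T K) (A K) (Bad K) (μ K) (Z K) (ev K) (obs K) ob (E K) (θ K) (mP K) (r K)) →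
      (∀ K, K₀ ≤ K →
        CutoffReading d N P (T K) (B K) (Bad K) (μ' K) (Z' K) (ev' K) (obs' K) ob (E' K) (θ' K) (mP' K) (r' K)) →
      Summable r → Summable r' →
      ShellWeightBound l₀ T A B shA shB Wsh →
      ReindexedBudget l₀ vol T (fun K t τ => A K t τ - shA K t τ) (fun K t τ => B K t τ - shB K t τ)
        (fun K _ => Bad K) Cc Rr CcRec RrRec ν u s₂ c₀ rr s →
      Summable rr → Summable u → Summable s → Summable s₂ →
      ∃ K₁ K₂, K₀ ≤ K₁ ∧ HybridNE7 l₀ vol (fun K => T (K₁ + (K₂ + K))) (fun K => A (K₁ + (K₂ + K)))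
        (fun K => B (K₁ + (K₂ + K))) (fun K _ => Bad (K₁ + (K₂ + K)))
        (fun K => Real.exp (2 * (ob * l₀)) * ((#P : ℝ) * (N : ℝ) ^ d * (r (K₁ + (K₂ + K)) + r' (K₁ + (K₂ + K)))))
        (fun K => shA (K₁ + (K₂ + K))) (fun K => shB (K₁ + (K₂ + K))) (fun K => Wsh (K₁ + (K₂ + K)))
        (fun K => (rr (K₁ + (K₂ + K)) + u (K₁ + (K₂ + K))) + (s (K₁ + (K₂ + K)) + s₂ (K₁ + (K₂ + K)))) :=
  (hybridNE7_of_cutoffReadings_fsc.{u, u', v, v'} D).underHypotheses Hβ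

/-- **THE ψ-CURRENCY W-ROAD END OF RECORD (W4, `hybridNE7_of_chessboard`, owner XREAD PASS l.13481) UNDER THE APEX PREFIX,
FOR EVERY DATUM** — two `ChessboardReading`s at `t = 0`, the two-sided dressing, summable rates, NE7c, NE7, rates; thresholds
`γ₁ = g₁ = 1`; no pin, no coupling window.  NE7b NOT proved. [folklore] -/
theorem hybridNE7_of_chessboard_fsc (D : FiniteEpsData F G) :
    ForSmallCouplings D fun _ =>
      ∀ {ι : Type u} {Λ : Type u'} [DecidableEq ι] {d N : ℕ} [NeZero N] {P : Finset Λ} {T : ℕ → Finset ι} {K₀ : ℕ}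
        {r r' : ℕ → ℝ} {l₀ m vol : ℝ} {A B shA shB Cc Rr CcRec RrRec : ℕ → ℝ → ι → ℝ} {Bad : ℕ → Finset ι}
        {ψA ψB : ℕ → Λ → Finset (BlockIdx d N) → ℝ} {ν u s₂ c₀ rr s Wsh : ℕ → ℝ},
      Even N →
      ChessboardReading d N P T (fun K => A K 0) Bad ψA r K₀ →
      ChessboardReading d N P T (fun K => B K 0) Bad ψB r' K₀ →
      Summable r → Summable r' →
      (∀ K t, |t| ≤ l₀ → K₀ ≤ K → ∀ τ ∈ T K, Real.exp (-m) * A K 0 τ ≤ A K t τ ∧ A K t τ ≤ Real.exp m * A K 0 τ) →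
      (∀ K t, |t| ≤ l₀ → K₀ ≤ K → ∀ τ ∈ T K, Real.exp (-m) * B K 0 τ ≤ B K t τ ∧ B K t τ ≤ Real.exp m * B K 0 τ) →
      ShellWeightBound l₀ T A B shA shB Wsh →
      ReindexedBudget l₀ vol T (fun K t τ => A K t τ - shA K t τ) (fun K t τ => B K t τ - shB K t τ)
        (fun K _ => Bad K) Cc Rr CcRec RrRec ν u s₂ c₀ rr s →
      Summable rr → Summable u → Summable s → Summable s₂ →
      ∃ K₁ K₂, K₀ ≤ K₁ ∧ HybridNE7 l₀ vol (fun K => T (K₁ + (K₂ + K))) (fun K => A (K₁ + (K₂ + K)))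
        (fun K => B (K₁ + (K₂ + K))) (fun K _ => Bad (K₁ + (K₂ + K)))
        (fun K => Real.exp (2 * m) * ((#P : ℝ) * (N : ℝ) ^ d * (r (K₁ + (K₂ + K)) + r' (K₁ + (K₂ + K)))))
        (fun K => shA (K₁ + (K₂ + K))) (fun K => shB (K₁ + (K₂ + K))) (fun K => Wsh (K₁ + (K₂ + K)))
        (fun K => (rr (K₁ + (K₂ + K)) + u (K₁ + (K₂ + K))) + (s (K₁ + (K₂ + K)) + s₂ (K₁ + (K₂ + K)))) :=
  ForSmallCouplings.of_forall fun _ => fun hN HA HB hr hr' hAd hBd hSh hTB hrr hu hs hs₂ =>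
    hybridNE7_of_chessboard hN HA HB hr hr' hAd hBd hSh hTB hrr hu hs hs₂

end

end Summit.QuantumFields.BalabanUV.T4Continuum.HistoryChessboardPinned
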